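import Literature.Computability.AlgebraicComplexity.MS21ANFOrbitsDistinctDepthProofs
import Literature.Computability.AlgebraicComplexity.MS21SigmaPiOrbitsProofs
import Literature.Computability.AlgebraicComplexity.MS21MultilinearIrreducibility
import HarnessLib

/-!
# Medini–Shpilka 2021, Lemma 5.12 (roanfMonInc): the base case `Δ = 1`

Brick S3 of the sizing memo `HOME/np/t20g5-MS21-lemma512-sizing.md` (val-lit, `MS2021_thm_35`
consortium): the case `Δ = 1` of the TR-free form of **Lemma 5.12** of Medini–Shpilka
(arXiv:2102.05632, p0027:L40–43; printed base case p0028:L1–6): if `g = ANF₁(Ax + b)`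
(`A ∈ GL₄`, `ANF₁ = x₀x₁ + x₂x₃`) has `mon(g) ⊆ mon(ANF₁)`, then `b = 0` ("the four leaf forms are
linearly independent, so the `1`-homogeneous part forces `α_i = 0`") and — the re-labelling remark after
Lemma 5.11 (p0027:L12–16) — `ANF₁(Ax) = β x₀x₁ + γ x₂x₃ = ANF₁(βx₀, x₁, γx₂, x₃)` with `β, γ ≠ 0`
(irreducibility of `ANF₁`, Obs. 2.7 = `MS2021.irreducible_add_add_C_of_multilinear_of_disjoint_vars`,
transported along the invertible substitution by `MS2021.aeval_affine_inv_apply`).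

Statement shape = memo §2 at `Δ = 1` (square matrix, `affSubst le_rfl`), so the implementer of the
induction (S4) can `exact` it in the base case. One private plumbing definition (`leaf`); no named
facts; nothing here bears on `VP ≠ VNP`.

## References
* [MediniShpilka2021] arXiv:2102.05632, Lemma 5.12 (p0027:L40) with its base case (p0028:L1–6), and
  the remark after Lemma 5.11 (p0027:L12–16).
-/

noncomputable section

open MvPolynomial Finset Matrix

namespace Literature.Computability.AlgebraicComplexity

namespace MS2021

variable {K : Type*} [Field K]

/-- The leaf `x^{(k)}_0` of `ANF₁`, i.e. the variable of block `k`. [cite: MediniShpilka2021, Def 8] -/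
private def leaf (k : Fin 4) : Fin (4 ^ 1) := anfBlock 0 k ⟨0, by norm_num⟩

/-- `leaf k` is the `k`-th variable. [cite: MediniShpilka2021, Def 8] -/
private theorem val_leaf (k : Fin 4) : ((leaf k : Fin (4 ^ 1)) : ℕ) = k := by
  simp [leaf, anfBlock, finProdFinEquiv]

/-- The four leaves are distinct. [cite: MediniShpilka2021, Def 8] -/
private theorem leaf_injective : Function.Injective (leaf : Fin 4 → Fin (4 ^ 1)) := by
  intro k k' h
  have := congrArg (fun i : Fin (4 ^ 1) => (i : ℕ)) h
  simp only [val_leaf] at this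
  exact Fin.ext this

/-- Every variable of `ANF₁` is a leaf. [cite: MediniShpilka2021, Def 8] -/
private theorem exists_eq_leaf (i : Fin (4 ^ 1)) : ∃ k, i = leaf k :=
  ⟨⟨i, i.isLt.trans_eq (by norm_num)⟩, Fin.ext (by rw [val_leaf])⟩

/-- `ANF₁ = x₀x₁ + x₂x₃` on its four leaves. [cite: MediniShpilka2021, Def 8] -/
private theorem anf_one :
    anf K 1 = X (leaf 0) * X (leaf 1) + X (leaf 2) * X (leaf 3) := by
  show rename _ (X _) * rename _ (X _) + rename _ (X _) * rename _ (X _) = _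
  simp only [rename_X]
  rfl

/-- The coefficient of `x_j` in a linear form. [folklore] -/
private theorem coeff_single_linearForm {n : ℕ} (c : Fin n → K) (j : Fin n) :
    coeff (Finsupp.single j 1) (∑ k : Fin n, C (c k) * X k : MvPolynomial (Fin n) K) = c j := by
  classical
  rw [coeff_sum, Finset.sum_eq_single j]
  · rw [coeff_C_mul, coeff_X, if_pos rfl, mul_one]
  · intro k _ hk
    rw [coeff_C_mul, coeff_X, if_neg (fun h => hk (Finsupp.single_left_injective one_ne_zero h)),
      mul_zero]
  · intro h; exact absurd (Finset.mem_univ j) h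

/-- A nonzero linear form is not a unit. [folklore] -/
private theorem not_isUnit_linearForm {n : ℕ} (c : Fin n → K) (hc : c ≠ 0) :
    ¬ IsUnit (∑ j : Fin n, C (c j) * X j : MvPolynomial (Fin n) K) := by
  classical
  intro hu
  obtain ⟨r, -, hr⟩ := isUnit_iff_eq_C_of_isReduced.mp hu
  apply hc
  funext j
  have := coeff_single_linearForm c j
  rw [hr, coeff_C, if_neg (Finsupp.single_ne_zero.mpr one_ne_zero).symm] at this
  exact this.symm

/-- **MS21 Lemma 5.12 for `Δ = 1`** (TR-free form of the sizing memo, square matrix): if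
`mon(ANF₁(Ax + b)) ⊆ mon(ANF₁)` with `A ∈ GL₄`, then `b = 0` and `ANF₁(Ax) = ANF₁(α • x ∘ π)` for a
permutation `π` fixing `ANF₁` (here `π = 1`) and nonzero scalars `α`.
[cite: MediniShpilka2021, Lemma 5.12 (case Δ = 1, p0028:L1–6) and remark after Lemma 5.11 (p0027:L12–16)] -/
theorem anf_one_rigidity_of_support_subset {A : Matrix (Fin (4 ^ 1)) (Fin (4 ^ 1)) K}
    (hA : IsUnit A.det) (b : Fin (4 ^ 1) → K)
    (h : (affSubst le_rfl A b (anf K 1)).support ⊆ (anf K 1).support) :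
    b = 0 ∧ ∃ (π : Equiv.Perm (Fin (4 ^ 1))) (α : Fin (4 ^ 1) → K), (∀ i, α i ≠ 0) ∧
      rename π (anf K 1) = anf K 1 ∧
      affSubst le_rfl A 0 (anf K 1) = aeval (fun i => C (α i) * X (π i)) (anf K 1) := by
  classical
  have h01 : leaf 0 ≠ leaf 1 := fun h => absurd (leaf_injective h) (by decide)
  have h02 : leaf 0 ≠ leaf 2 := fun h => absurd (leaf_injective h) (by decide)
  have h03 : leaf 0 ≠ leaf 3 := fun h => absurd (leaf_injective h) (by decide)
  have h12 : leaf 1 ≠ leaf 2 := fun h => absurd (leaf_injective h) (by decide)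
  have h13 : leaf 1 ≠ leaf 3 := fun h => absurd (leaf_injective h) (by decide)
  have h23 : leaf 2 ≠ leaf 3 := fun h => absurd (leaf_injective h) (by decide)
  -- the linear forms `ℓ i = ∑_j A i j x_j`
  set ℓ : Fin (4 ^ 1) → MvPolynomial (Fin (4 ^ 1)) K := fun i => ∑ j, C (A i j) * X j with hℓ
  have hℓhom : ∀ i, (ℓ i).IsHomogeneous 1 := by
    intro i
    refine IsHomogeneous.sum _ _ _ fun j _ => ?_
    simpa using (isHomogeneous_C _ (A i j)).mul (isHomogeneous_X K j)
  have hcast : ∀ (h' : 4 ^ 1 ≤ 4 ^ 1) (i : Fin (4 ^ 1)), Fin.castLE h' i = i := fun _ _ => Fin.ext rfl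
  have hsub : ∀ c : Fin (4 ^ 1) → K, affSubst le_rfl A c (anf K 1) =
      (ℓ (leaf 0) + C (c (leaf 0))) * (ℓ (leaf 1) + C (c (leaf 1))) +
        (ℓ (leaf 2) + C (c (leaf 2))) * (ℓ (leaf 3) + C (c (leaf 3))) := by
    intro c
    rw [affSubst, anf_one]
    simp only [map_add, map_mul, aeval_X, hcast, hℓ]
  -- (1) `b = 0`
  have hcoef1 : ∀ j : Fin (4 ^ 1), coeff (Finsupp.single j 1) (affSubst le_rfl A b (anf K 1)) = 0 := by
    intro j
    rw [← notMem_support_iff]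
    intro hj
    exact (mem_support_iff.mp (h hj)) ((isHomogeneous_anf K 1).coeff_eq_zero
      (by rw [Finsupp.degree_single]; norm_num))
  have hcoefprod : ∀ (i i' : Fin (4 ^ 1)) (c c' : K) (j : Fin (4 ^ 1)),
      coeff (Finsupp.single j 1) ((ℓ i + C c) * (ℓ i' + C c')) = c' * A i j + c * A i' j := by
    intro i i' c c' j
    have h2 : coeff (Finsupp.single j 1) (ℓ i * ℓ i') = 0 :=
      ((hℓhom i).mul (hℓhom i')).coeff_eq_zero (by rw [Finsupp.degree_single]; norm_num)
    rw [add_mul, mul_add, mul_add, coeff_add, coeff_add, coeff_add, h2, zero_add,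
      mul_comm (ℓ i) (C c'), coeff_C_mul, coeff_C_mul, coeff_single_linearForm,
      coeff_single_linearForm, ← C_mul, coeff_C,
      if_neg (Finsupp.single_ne_zero.mpr one_ne_zero).symm, add_zero]
  -- the twisted vector `c` with `c ᵥ* A = 0`
  set c : Fin (4 ^ 1) → K := fun i =>
    if i = leaf 0 then b (leaf 1) else if i = leaf 1 then b (leaf 0)
      else if i = leaf 2 then b (leaf 3) else b (leaf 2) with hc
  have hc0 : c (leaf 0) = b (leaf 1) := by simp [hc]
  have hc1 : c (leaf 1) = b (leaf 0) := by simp [hc, h01.symm]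
  have hc2 : c (leaf 2) = b (leaf 3) := by simp [hc, h02.symm, h12.symm]
  have hc3 : c (leaf 3) = b (leaf 2) := by simp [hc, h03.symm, h13.symm, h23.symm]
  have huniv : (Finset.univ : Finset (Fin (4 ^ 1))) = {leaf 0, leaf 1, leaf 2, leaf 3} := by
    ext i
    simp only [Finset.mem_univ, Finset.mem_insert, Finset.mem_singleton, true_iff]
    obtain ⟨k, rfl⟩ := exists_eq_leaf i
    fin_cases k
    · exact Or.inl rfl
    · exact Or.inr (Or.inl rfl)
    · exact Or.inr (Or.inr (Or.inl rfl))
    · exact Or.inr (Or.inr (Or.inr rfl))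
  have hvec : Matrix.vecMul c A = 0 := by
    funext j
    have hj := hcoef1 j
    rw [hsub, coeff_add, hcoefprod, hcoefprod] at hj
    change ∑ i, c i * A i j = 0
    rw [huniv, Finset.sum_insert (by simp [h01, h02, h03]), Finset.sum_insert (by simp [h12, h13]),
      Finset.sum_insert (by simp [h23]), Finset.sum_singleton, hc0, hc1, hc2, hc3, ← hj]
    ring
  have hcz : c = 0 := by
    have := congrArg (fun v => Matrix.vecMul v A⁻¹) hvec
    simpa only [Matrix.vecMul_vecMul, Matrix.mul_nonsing_inv _ hA, Matrix.vecMul_one,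
      Matrix.zero_vecMul] using this
  have hb : b = 0 := by
    funext i
    obtain ⟨k, rfl⟩ := exists_eq_leaf i
    fin_cases k
    · simpa [hc1] using congrFun hcz (leaf 1)
    · simpa [hc0] using congrFun hcz (leaf 0)
    · simpa [hc3] using congrFun hcz (leaf 3)
    · simpa [hc2] using congrFun hcz (leaf 2)
  refine ⟨hb, ?_⟩
  subst hb
  -- (2) with `b = 0`: `g₀ = β x₀x₁ + γ x₂x₃`
  set g0 := affSubst le_rfl A 0 (anf K 1) with hg0
  set m01 : Fin (4 ^ 1) →₀ ℕ := Finsupp.single (leaf 0) 1 + Finsupp.single (leaf 1) 1 with hm01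
  set m23 : Fin (4 ^ 1) →₀ ℕ := Finsupp.single (leaf 2) 1 + Finsupp.single (leaf 3) 1 with hm23
  have hX01 : (X (leaf 0) * X (leaf 1) : MvPolynomial (Fin (4 ^ 1)) K) = monomial m01 1 := by
    rw [X, X, monomial_mul, mul_one]
  have hX23 : (X (leaf 2) * X (leaf 3) : MvPolynomial (Fin (4 ^ 1)) K) = monomial m23 1 := by
    rw [X, X, monomial_mul, mul_one]
  have hsuppanf : (anf K 1).support ⊆ {m01, m23} := by
    rw [anf_one, hX01, hX23]
    refine support_add.trans (Finset.union_subset ?_ ?_)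
    · exact support_monomial_subset.trans (by simp)
    · exact support_monomial_subset.trans (by simp)
  have hm0123 : m01 ≠ m23 := by
    intro hm
    have := congrArg (fun m : Fin (4 ^ 1) →₀ ℕ => m (leaf 0)) hm
    simp [hm01, hm23, h02, h03] at this
  set β : K := coeff m01 g0 with hβ
  set γ : K := coeff m23 g0 with hγ
  have hg0eq : g0 = C β * (X (leaf 0) * X (leaf 1)) + C γ * (X (leaf 2) * X (leaf 3)) := by
    have hs : g0.support ⊆ {m01, m23} := h.trans hsuppanf
    conv_lhs => rw [g0.as_sum, Finset.sum_subset hs (fun m _ hm => by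
      rw [notMem_support_iff.mp hm, monomial_zero])]
    rw [Finset.sum_pair hm0123, hX01, hX23, C_mul_monomial, C_mul_monomial, mul_one, mul_one]
  -- (3) `β, γ ≠ 0`: `ANF₁` is irreducible and is recovered from `g₀` by the inverse substitution
  have hirr : Irreducible (anf K 1) := by
    rw [anf_one, ← add_zero (X (leaf 0) * X (leaf 1) + X (leaf 2) * X (leaf 3)), ← C_0]
    refine irreducible_add_add_C_of_multilinear_of_disjoint_vars ?_ ?_ ?_ ?_ ?_ (0 : K)
    · intro i
      refine (degreeOf_mul_le i _ _).trans ?_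
      rw [degreeOf_X, degreeOf_X]
      by_cases hi0 : i = leaf 0
      · subst hi0; simp [h01]
      · by_cases hi1 : i = leaf 1
        · subst hi1; simp [hi0]
        · simp [hi0, hi1]
    · intro i
      refine (degreeOf_mul_le i _ _).trans ?_
      rw [degreeOf_X, degreeOf_X]
      by_cases hi2 : i = leaf 2
      · subst hi2; simp [h23]
      · by_cases hi3 : i = leaf 3
        · subst hi3; simp [hi2]
        · simp [hi2, hi3]
    · rw [hX01, hX23, vars_monomial one_ne_zero, vars_monomial one_ne_zero]
      refine Finset.disjoint_left.mpr fun i hi hi' => ?_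
      have hi1 : i = leaf 0 ∨ i = leaf 1 := by
        simpa [hm01, Finsupp.support_add_eq, Finset.mem_union] using
          (Finsupp.support_add (g₁ := Finsupp.single (leaf 0) 1) (g₂ := Finsupp.single (leaf 1) 1)) hi
      have hi2 : i = leaf 2 ∨ i = leaf 3 := by
        simpa [hm23] using
          (Finsupp.support_add (g₁ := Finsupp.single (leaf 2) 1) (g₂ := Finsupp.single (leaf 3) 1)) hi'
      rcases hi1 with rfl | rfl <;> rcases hi2 with h' | h'
      · exact h02 h'
      · exact h03 h'
      · exact h12 h'
      · exact h13 h'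
    · refine ⟨leaf 0, ?_⟩
      rw [hX01, vars_monomial one_ne_zero, hm01, Finsupp.mem_support_iff]
      simp [h01]
    · refine ⟨leaf 2, ?_⟩
      rw [hX23, vars_monomial one_ne_zero, hm23, Finsupp.mem_support_iff]
      simp [h23]
  set Ψ : Fin (4 ^ 1) → MvPolynomial (Fin (4 ^ 1)) K :=
    fun i => (∑ j, C (A⁻¹ i j) * X j) + C ((-(A⁻¹ *ᵥ (0 : Fin (4 ^ 1) → K))) i) with hΨ
  have hΨeq : ∀ i, Ψ i = ∑ j, C (A⁻¹ i j) * X j := by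
    intro i; rw [hΨ]; simp
  have hinv : aeval Ψ g0 = anf K 1 := by
    have := aeval_affine_inv_apply hA (0 : Fin (4 ^ 1) → K) (anf K 1)
    rw [hg0, affSubst]
    simp only [hcast]
    exact this
  have hΨnu : ∀ i, ¬ IsUnit (Ψ i) := by
    intro i
    have hrow : A⁻¹ i ≠ 0 := by
      intro h0
      have hdet : (A⁻¹).det = 0 := Matrix.det_eq_zero_of_row_eq_zero i (fun j => by rw [h0]; rfl)
      exact (Matrix.isUnit_nonsing_inv_det A hA).ne_zero hdet
    rw [hΨeq]
    exact not_isUnit_linearForm (A⁻¹ i) hrow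
  have hβ0 : β ≠ 0 := by
    intro hβ0
    have h1 : anf K 1 = (C γ * Ψ (leaf 2)) * Ψ (leaf 3) := by
      rw [← hinv, hg0eq, hβ0, C_0, zero_mul, zero_add, map_mul, map_mul, aeval_C, aeval_X, aeval_X,
        MvPolynomial.algebraMap_eq, mul_assoc]
    rcases hirr.isUnit_or_isUnit h1 with hu | hu
    · exact hΨnu (leaf 2) (isUnit_of_mul_isUnit_right hu)
    · exact hΨnu (leaf 3) hu
  have hγ0 : γ ≠ 0 := by
    intro hγ0
    have h1 : anf K 1 = (C β * Ψ (leaf 0)) * Ψ (leaf 1) := by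
      rw [← hinv, hg0eq, hγ0, C_0, zero_mul, add_zero, map_mul, map_mul, aeval_C, aeval_X, aeval_X,
        MvPolynomial.algebraMap_eq, mul_assoc]
    rcases hirr.isUnit_or_isUnit h1 with hu | hu
    · exact hΨnu (leaf 0) (isUnit_of_mul_isUnit_right hu)
    · exact hΨnu (leaf 1) hu
  -- (4) assemble with `π = 1`
  set α : Fin (4 ^ 1) → K := fun i => if i = leaf 0 then β else if i = leaf 2 then γ else 1 with hα
  have hα0 : α (leaf 0) = β := by simp [hα]
  have hα1 : α (leaf 1) = 1 := by simp [hα, h01.symm, h12]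
  have hα2 : α (leaf 2) = γ := by simp [hα, Ne.symm h02]
  have hα3 : α (leaf 3) = 1 := by simp [hα, h03.symm, Ne.symm h23]
  refine ⟨1, α, ?_, ?_, ?_⟩
  · intro i
    by_cases hi0 : i = leaf 0
    · rw [hi0, hα0]; exact hβ0
    · by_cases hi2 : i = leaf 2
      · rw [hi2, hα2]; exact hγ0
      · simp [hα, hi0, hi2]
  · simp
  · rw [hg0eq, anf_one]
    simp only [map_add, map_mul, aeval_X, Equiv.Perm.coe_one, id_eq, hα0, hα1, hα2, hα3, C_1, one_mul]
    ring

end MS2021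

end Literature.Computability.AlgebraicComplexity

end
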